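import Literature.Analysis.Fourier.RadialSchwartzInterpolationGaussian
import Mathlib.Analysis.Calculus.ParametricIntegral
import HarnessLib

/-!
# Gaussian–Laplace transforms `r ↦ ∫ K(t) e^{−πr²t} dt` are Schwartz functions

Cohn–Kumar–Miller–Radchenko–Viazovska, arXiv:1902.05438, §5.1: the pieces
`F_{2,low}(τ,r) = 4 sin²(πr²/2)∫₀^p 𝒦(τ,it)e^{−πr²t}dt` and
`F_{2,trunc}(τ,r) = 4 sin²(πr²/2)∫_p^∞ (𝒦 − 𝒢)(τ,it)e^{−πr²t}dt` are "averages of Gaussians";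
differentiating under the integral sign and using
`max_r |r^c e^{−πr²t}| = (c/2πet)^{c/2}` (5.4) shows that they are Schwartz functions of `r` whose
seminorms are controlled by moments of the weight.

PROVED here, for a weight `K` on a set `I ⊆ (0,∞)` all of whose real moments `∫_I |K(t)| t^s dt`
are finite: with `G_n(r) = ∫_I K(t) ∂_r^n e^{−πr²t} dt`,
* `|r|^k |∂_r^n e^{−πr²t}| ≤ C_{n,k} t^{(n−k)/2}` (scaling `e^{−πr²t} = φ(r√t)`, `φ` the Schwartz Gaussian);
* `G_n` is differentiable with derivative `G_{n+1}` (dominated differentiation), `∂^n G_0 = G_n`,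
  `G_0` is smooth, and **`|r|^k|G_n(r)| ≤ C_{n,k} ∫_I |K(t)| t^{(n−k)/2} dt`** with `C_{n,k}` absolute;
* `laplaceGaussSchwartz K I : 𝓢(ℝ, ℂ)`, the function `G_0` as a Schwartz map.

## References

* H. Cohn, A. Kumar, S. D. Miller, D. Radchenko, M. Viazovska, Ann. of Math. 196 (2022),
  arXiv:1902.05438, §5.1 (5.2)–(5.4). [CohnEtAl2019]
-/

noncomputable section

open scoped SchwartzMap Topology UpperHalfPlane ContDiff
open Filter Complex MeasureTheory Set Real

namespace Literature.Analysis.Fourier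

/-! ## The Gaussian and its scaled derivatives -/

/-- The one-dimensional Schwartz Gaussian `φ(x) = e^{−πx²}` (`= complexGaussian ℝ i`). [cite: CohnEtAl2019, §5.1] -/
def gaussφ : 𝓢(ℝ, ℂ) := complexGaussian ℝ UpperHalfPlane.I

/-- `gaussφ_apply` (auxiliary). [cite: CohnEtAl2019, §5.1] -/
theorem gaussφ_apply (x : ℝ) : gaussφ x = (Real.exp (-Real.pi * x ^ 2) : ℂ) := by
  rw [gaussφ, complexGaussian_apply, Complex.ofReal_exp]
  congr 1
  have hx : ((‖x‖ : ℝ) : ℂ) ^ 2 = (x : ℂ) ^ 2 := by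
    rw [← Complex.ofReal_pow, Real.norm_eq_abs, sq_abs, Complex.ofReal_pow]
  rw [hx, UpperHalfPlane.coe_I]
  push_cast
  ring_nf
  rw [I_sq]
  ring

/-- The `n`-th `r`-derivative kernel of `e^{−πr²t}`, written via the scaling `e^{−πr²t} = φ(√t·r)`:
`D_n(t,r) = (√t)^n φ^{(n)}(√t r)` (a continuous function of `(t,r)` on all of `ℝ²`). [cite: CohnEtAl2019, §5.1] -/
def gaussD (n : ℕ) (t r : ℝ) : ℂ := ((Real.sqrt t) ^ n : ℝ) • iteratedDeriv n gaussφ (Real.sqrt t * r)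

/-- `gaussD_eq_iteratedDeriv` (auxiliary). [cite: CohnEtAl2019, §5.1] -/
theorem gaussD_eq_iteratedDeriv (n : ℕ) {t : ℝ} (ht : 0 ≤ t) (r : ℝ) :
    gaussD n t r = iteratedDeriv n (fun s : ℝ => (Real.exp (-Real.pi * s ^ 2 * t) : ℂ)) r := by
  have hφ : ContDiff ℝ n (gaussφ : ℝ → ℂ) := gaussφ.smooth n
  have key : (fun s : ℝ => (Real.exp (-Real.pi * s ^ 2 * t) : ℂ)) = fun s => gaussφ (Real.sqrt t * s) := by
    funext s
    rw [gaussφ_apply]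
    congr 2
    rw [mul_pow, Real.sq_sqrt ht]; ring
  rw [key, iteratedDeriv_comp_const_smul hφ, gaussD]

/-- `gaussD_zero` (auxiliary). [cite: CohnEtAl2019, §5.1] -/
theorem gaussD_zero (t r : ℝ) (ht : 0 ≤ t) : gaussD 0 t r = (Real.exp (-Real.pi * r ^ 2 * t) : ℂ) := by
  rw [gaussD_eq_iteratedDeriv 0 ht, iteratedDeriv_zero]

/-- `continuous_gaussD` (auxiliary). [cite: CohnEtAl2019, §5.1] -/
theorem continuous_gaussD (n : ℕ) : Continuous fun p : ℝ × ℝ => gaussD n p.1 p.2 := by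
  have hc : Continuous (iteratedDeriv n (gaussφ : ℝ → ℂ)) := (gaussφ.smooth n).continuous_iteratedDeriv n (mod_cast le_rfl)
  unfold gaussD
  exact ((Complex.continuous_ofReal.comp ((Real.continuous_sqrt.comp continuous_fst).pow n)).smul
    (hc.comp ((Real.continuous_sqrt.comp continuous_fst).mul continuous_snd)))

/-- `hasDerivAt_gaussD` (auxiliary). [cite: CohnEtAl2019, §5.1] -/
theorem hasDerivAt_gaussD (n : ℕ) (t r : ℝ) : HasDerivAt (fun s => gaussD n t s) (gaussD (n + 1) t r) r := by
  have hφ : ContDiff ℝ (n + 1 : ℕ) (gaussφ : ℝ → ℂ) := gaussφ.smooth (n + 1 : ℕ)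
  have hd : HasDerivAt (iteratedDeriv n (gaussφ : ℝ → ℂ)) (iteratedDeriv (n + 1) gaussφ (Real.sqrt t * r)) (Real.sqrt t * r) := by
    rw [iteratedDeriv_succ]
    exact ((hφ.differentiable_iteratedDeriv n (mod_cast Nat.lt_succ_self n)).differentiableAt).hasDerivAt
  have hmul : HasDerivAt (fun s : ℝ => Real.sqrt t * s) (Real.sqrt t) r := by
    simpa using (hasDerivAt_id r).const_mul (Real.sqrt t)
  have key := (hd.scomp r hmul).const_smul ((Real.sqrt t) ^ n : ℝ)
  have e : gaussD (n + 1) t r = ((Real.sqrt t) ^ n : ℝ) • (Real.sqrt t • iteratedDeriv (n + 1) (gaussφ : ℝ → ℂ) (Real.sqrt t * r)) := by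
    rw [gaussD, smul_smul, pow_succ]
  rw [e]
  exact key

/-- **`|r|^k |∂_r^n e^{−πr²t}| ≤ C_{n,k} t^{(n−k)/2}`** for `t > 0`, with `C_{n,k}` a Schwartz seminorm of the Gaussian.
[cite: CohnEtAl2019, §5.1 (5.4)] -/
theorem gaussD_bound (n k : ℕ) : ∃ C : ℝ, 0 ≤ C ∧ ∀ t : ℝ, 0 < t → ∀ r : ℝ,
    |r| ^ k * ‖gaussD n t r‖ ≤ C * t ^ (((n : ℝ) - k) / 2) := by
  obtain ⟨C, hCpos, hC⟩ := gaussφ.decay k n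
  refine ⟨C, hCpos.le, fun t ht r => ?_⟩
  have hs : 0 < Real.sqrt t := Real.sqrt_pos.2 ht
  have hx := hC (Real.sqrt t * r)
  rw [norm_iteratedFDeriv_eq_norm_iteratedDeriv, Real.norm_eq_abs, abs_mul, abs_of_pos hs, mul_pow] at hx
  -- `|r|^k ‖D_n‖ = t^{n/2} t^{-k/2} (√t)^k |r|^k ‖φ^{(n)}(√t r)‖`
  have hnorm : ‖gaussD n t r‖ = Real.sqrt t ^ n * ‖iteratedDeriv n (gaussφ : ℝ → ℂ) (Real.sqrt t * r)‖ := by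
    rw [gaussD, norm_smul, Real.norm_eq_abs, abs_of_nonneg (pow_nonneg hs.le n)]
  rw [hnorm]
  have hsq : Real.sqrt t ^ 2 = t := Real.sq_sqrt ht.le
  have hpow : t ^ (((n : ℝ) - k) / 2) = Real.sqrt t ^ n / Real.sqrt t ^ k := by
    rw [Real.sqrt_eq_rpow, ← Real.rpow_natCast, ← Real.rpow_natCast, ← Real.rpow_mul ht.le, ← Real.rpow_mul ht.le,
      ← Real.rpow_sub ht]
    congr 1; ring
  rw [hpow]
  rw [show |r| ^ k * (Real.sqrt t ^ n * ‖iteratedDeriv n (⇑gaussφ) (Real.sqrt t * r)‖) =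
    (Real.sqrt t ^ k * |r| ^ k * ‖iteratedDeriv n (⇑gaussφ) (Real.sqrt t * r)‖) * (Real.sqrt t ^ n / Real.sqrt t ^ k) by
      field_simp]
  exact mul_le_mul_of_nonneg_right hx (by positivity)

/-! ## The transform and differentiation under the integral sign -/

/-- `G_n(r) = ∫_I K(t) ∂_r^n e^{−πr²t} dt`. [cite: CohnEtAl2019, §5.1 (5.3)] -/
def laplaceGauss (K : ℝ → ℂ) (I : Set ℝ) (n : ℕ) (r : ℝ) : ℂ := ∫ t in I, K t * gaussD n t r

/-- Standing hypotheses: `I ⊆ (0,∞)` measurable, `K` a.e.-strongly measurable on `I`, and all real moments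
`∫_I |K(t)| t^s dt` finite. [cite: CohnEtAl2019, §5.1] -/
structure LaplaceWeight (K : ℝ → ℂ) (I : Set ℝ) : Prop where
  subset : I ⊆ Ioi 0
  measurableSet : MeasurableSet I
  aesm : AEStronglyMeasurable K (volume.restrict I)
  moments : ∀ s : ℝ, IntegrableOn (fun t => ‖K t‖ * t ^ s) I

namespace LaplaceWeight

variable {K : ℝ → ℂ} {I : Set ℝ}

/-- `integrable_mul_gaussD` (auxiliary). [cite: CohnEtAl2019, §5.1] -/
theorem integrable_mul_gaussD (h : LaplaceWeight K I) (n : ℕ) (r : ℝ) :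
    Integrable (fun t => K t * gaussD n t r) (volume.restrict I) := by
  obtain ⟨C, hC0, hC⟩ := gaussD_bound n 0
  have hm : AEStronglyMeasurable (fun t => K t * gaussD n t r) (volume.restrict I) :=
    h.aesm.mul ((continuous_gaussD n).comp (continuous_id.prodMk continuous_const)).aestronglyMeasurable
  refine Integrable.mono' ((h.moments ((n : ℝ) / 2)).const_mul C) hm ?_
  filter_upwards [ae_restrict_mem h.measurableSet] with t ht
  have ht0 : 0 < t := h.subset ht
  have hb := hC t ht0 r
  simp only [pow_zero, one_mul, Nat.cast_zero, sub_zero] at hb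
  rw [norm_mul]
  calc ‖K t‖ * ‖gaussD n t r‖ ≤ ‖K t‖ * (C * t ^ ((n : ℝ) / 2)) := mul_le_mul_of_nonneg_left hb (norm_nonneg _)
    _ = C * (‖K t‖ * t ^ ((n : ℝ) / 2)) := by ring

/-- **Differentiation under the integral sign**: `G_n' = G_{n+1}`. [cite: CohnEtAl2019, §5.1] -/
theorem hasDerivAt_laplaceGauss (h : LaplaceWeight K I) (n : ℕ) (r₀ : ℝ) :
    HasDerivAt (laplaceGauss K I n) (laplaceGauss K I (n + 1) r₀) r₀ := by
  obtain ⟨C, hC0, hC⟩ := gaussD_bound (n + 1) 0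
  have hmeas : ∀ r, AEStronglyMeasurable (fun t => K t * gaussD n t r) (volume.restrict I) := fun r =>
    h.aesm.mul ((continuous_gaussD n).comp (continuous_id.prodMk continuous_const)).aestronglyMeasurable
  have hmeas' : AEStronglyMeasurable (fun t => K t * gaussD (n + 1) t r₀) (volume.restrict I) :=
    h.aesm.mul ((continuous_gaussD (n + 1)).comp (continuous_id.prodMk continuous_const)).aestronglyMeasurable
  have key := hasDerivAt_integral_of_dominated_loc_of_deriv_le (μ := volume.restrict I) (x₀ := r₀) (s := univ)
    (F := fun r t => K t * gaussD n t r) (F' := fun r t => K t * gaussD (n + 1) t r)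
    (bound := fun t => C * (‖K t‖ * t ^ (((n + 1 : ℕ) : ℝ) / 2))) univ_mem
    (Eventually.of_forall hmeas) (h.integrable_mul_gaussD n r₀) hmeas' ?_ ((h.moments (((n + 1 : ℕ) : ℝ) / 2)).const_mul C) ?_
  · exact key.2
  · filter_upwards [ae_restrict_mem h.measurableSet] with t ht r _
    have ht0 : 0 < t := h.subset ht
    have hb := hC t ht0 r
    simp only [pow_zero, one_mul, Nat.cast_zero, sub_zero] at hb
    rw [norm_mul]
    calc ‖K t‖ * ‖gaussD (n + 1) t r‖ ≤ ‖K t‖ * (C * t ^ (((n + 1 : ℕ) : ℝ) / 2)) :=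
          mul_le_mul_of_nonneg_left hb (norm_nonneg _)
      _ = C * (‖K t‖ * t ^ (((n + 1 : ℕ) : ℝ) / 2)) := by ring
  · exact Eventually.of_forall fun t r _ => (hasDerivAt_gaussD n t r).const_mul (K t)

/-- `deriv_laplaceGauss` (auxiliary). [cite: CohnEtAl2019, §5.1] -/
theorem deriv_laplaceGauss (h : LaplaceWeight K I) (n : ℕ) : deriv (laplaceGauss K I n) = laplaceGauss K I (n + 1) :=
  funext fun r => (h.hasDerivAt_laplaceGauss n r).deriv

/-- `iteratedDeriv_laplaceGauss` (auxiliary). [cite: CohnEtAl2019, §5.1] -/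
theorem iteratedDeriv_laplaceGauss (h : LaplaceWeight K I) (n : ℕ) : iteratedDeriv n (laplaceGauss K I 0) = laplaceGauss K I n := by
  induction n with
  | zero => simp
  | succ n ih => rw [iteratedDeriv_succ, ih, h.deriv_laplaceGauss]

/-- `differentiable_laplaceGauss` (auxiliary). [cite: CohnEtAl2019, §5.1] -/
theorem differentiable_laplaceGauss (h : LaplaceWeight K I) (n : ℕ) : Differentiable ℝ (laplaceGauss K I n) :=
  fun r => (h.hasDerivAt_laplaceGauss n r).differentiableAt

/-- `G_0` is smooth. [cite: CohnEtAl2019, §5.1] -/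
theorem contDiff_laplaceGauss (h : LaplaceWeight K I) : ContDiff ℝ ∞ (laplaceGauss K I 0) :=
  contDiff_of_differentiable_iteratedDeriv fun m _ => by rw [h.iteratedDeriv_laplaceGauss]; exact h.differentiable_laplaceGauss m

/-- **Seminorm bound**: `|r|^k |G_n(r)| ≤ C_{n,k} ∫_I |K(t)| t^{(n−k)/2} dt` with `C_{n,k}` independent of `K, I`.
[cite: CohnEtAl2019, §5.1 (5.4)] -/
theorem seminorm_laplaceGauss_le (n k : ℕ) : ∃ C : ℝ, 0 ≤ C ∧ ∀ {K : ℝ → ℂ} {I : Set ℝ}, LaplaceWeight K I →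
    ∀ r : ℝ, |r| ^ k * ‖laplaceGauss K I n r‖ ≤ C * ∫ t in I, ‖K t‖ * t ^ (((n : ℝ) - k) / 2) := by
  obtain ⟨C, hC0, hC⟩ := gaussD_bound n k
  refine ⟨C, hC0, fun {K I} h r => ?_⟩
  rw [laplaceGauss, ← integral_const_mul]
  have hrk : 0 ≤ |r| ^ k := by positivity
  calc |r| ^ k * ‖∫ t in I, K t * gaussD n t r‖ ≤ |r| ^ k * ∫ t in I, ‖K t * gaussD n t r‖ :=
        mul_le_mul_of_nonneg_left (norm_integral_le_integral_norm _) hrk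
    _ = ∫ t in I, |r| ^ k * ‖K t * gaussD n t r‖ := (integral_const_mul _ _).symm
    _ ≤ ∫ t in I, C * (‖K t‖ * t ^ (((n : ℝ) - k) / 2)) := by
        refine integral_mono_ae (((h.integrable_mul_gaussD n r).norm).const_mul _) ((h.moments _).const_mul C) ?_
        filter_upwards [ae_restrict_mem h.measurableSet] with t ht
        have ht0 : 0 < t := h.subset ht
        rw [norm_mul, mul_left_comm]
        calc ‖K t‖ * (|r| ^ k * ‖gaussD n t r‖) ≤ ‖K t‖ * (C * t ^ (((n : ℝ) - k) / 2)) :=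
              mul_le_mul_of_nonneg_left (hC t ht0 r) (norm_nonneg _)
          _ = C * (‖K t‖ * t ^ (((n : ℝ) - k) / 2)) := by ring

/-- **The Gaussian–Laplace transform as a Schwartz function of `r`.** [cite: CohnEtAl2019, §5.1] -/
def laplaceGaussSchwartz (h : LaplaceWeight K I) : 𝓢(ℝ, ℂ) where
  toFun := laplaceGauss K I 0
  smooth' := h.contDiff_laplaceGauss
  decay' k n := by
    obtain ⟨C, _, hC⟩ := seminorm_laplaceGauss_le n k
    refine ⟨C * ∫ t in I, ‖K t‖ * t ^ (((n : ℝ) - k) / 2), fun r => ?_⟩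
    rw [norm_iteratedFDeriv_eq_norm_iteratedDeriv, h.iteratedDeriv_laplaceGauss, Real.norm_eq_abs]
    exact hC h r

/-- `laplaceGaussSchwartz_apply` (auxiliary). [cite: CohnEtAl2019, §5.1] -/
@[simp] theorem laplaceGaussSchwartz_apply (h : LaplaceWeight K I) (r : ℝ) :
    h.laplaceGaussSchwartz r = ∫ t in I, K t * (Real.exp (-Real.pi * r ^ 2 * t) : ℂ) := by
  show laplaceGauss K I 0 r = _
  rw [laplaceGauss]
  refine setIntegral_congr_fun h.measurableSet fun t ht => ?_
  rw [gaussD_zero t r (h.subset ht).le]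

end LaplaceWeight

end Literature.Analysis.Fourier
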